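import Summits.CriticalPhenomena.PercolationContinuityZ3.Theorems.PercNearOneGluingNoHeavyLowerTailUpsetExchange
import Summits.CriticalPhenomena.PercolationContinuityZ3.Theorems.PercNearOneGluingAdditiveGluingGluingLemma5
import HarnessLib

/-!
# `NoHeavyLowerTail` (stmt-CriticalPhenomena-4575) — the up-set exchange for UNION events and for an anchor
# INSIDE the block; two new certificate leaves for Kozma–Nitzan's Question 9 on glued one-layer blocks

Support file (lemma factory `prim-lf-3` gen 6, seat g7; `--supports stmt-CriticalPhenomena-4575`).  No definitions,
no named facts, no sorries.  Memo: `run/shared/lean/prim/prim-lf-3/LF3-Q9LP.md` §1, §3.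

Setting (`Fin n`, weights `w` = the RANKING graph, e.g. the split graph of a depth-two observer; `glue_S w` = every
non-loop pair inside the block `S` given weight `1`).  `UpsetExchange.upsetExchange_any` (prim-hp-1) is Kozma–Nitzan's
Lemma 5 with the comparison relay ranked in `w` and the conclusion on an up-set piece `{C open}`, `C` a set of pairs
meeting `S` that contains a pair to the anchor `v ∉ S`.  Here:

* `upsetExchange_event` — the same conclusion for an ARBITRARY event `E` such that `E ∩ {S internally open}` is
  increasing in the open edge cluster of the anchor `v` (the only property the ε-sprinkling proof uses):
  `μ_w(a ↔ b) ≤ μ_w(v ↔ b)` ⟹ `μ_{glue_S w}(a ↔ b, E) ≤ μ_{glue_S w}(v ↔ b, E)`.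
* `upsetExchange_union` / `upsetExchange_union_block` — `E = ⋃_{C ∈ 𝒞} {C open}` for a finite family `𝒞` of
  pair-sets meeting `S`, EACH containing a pair `s(s_C, v)` to the common anchor `v ∉ S`.  Simplest instance:
  `E = {some pair between S and v is open}` — the RELAY-LEVEL up-set exchange: a relay attached to the block by
  several pairs (shared port of two hubs) is handled by ONE inequality, with no conditioning on closed pairs.
  A union of principal up-sets is not a nonnegative combination of principal up-set indicators, so this is not a
  consequence of the `{C open}` family.
* `hubExchange_union` — anchor `v ∈ S` (a member of the block): for every finite family `𝒞` of pair-sets meeting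
  `S` (no anchor condition), `μ_w(a ↔ b) ≤ μ_w(v ↔ b)` ⟹ `μ_{glue_S w}(a ↔ b, E) ≤ μ_{glue_S w}(v ↔ b, E)`.
* `blockQ9_of_hubDominated` — HUB-DOMINATION LEAF for Question 9 on a glued block: if the anchor relay `a` is at most
  as connected to `b` IN THE RANKING GRAPH `w` as some member `u ∈ S` of the block, then
  `μ_{glue_S w}(a ↔ b, S ↔ A) ≤ μ_{glue_S w}(S ↔ b)`  (`S ↔ A` := `⋃_{s∈S} ⋃_{a'∈A} {s ↔ a'}`), for every `A`.
  (Compare `BlockQ9.blockQ9_of_reliableBlock` (prim-lf-1): comparison with the GLUED block in `glue_S w`; here the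
  comparison is with one member in the unglued ranking graph `w`, which is where the Question-9 relay is ranked.)
* (companion file `…BlockQ9OneDangerousRelay.lean`) `BlockQ9.blockQ9_oneDangerousRelay` — Question 9 for a one-layer block
  with ONE dangerous relay attached by ANY number of pairs, from `upsetExchange_event` + `BlockQ9.blockThm4_witness`.

Proof of `upsetExchange_event`: verbatim the sprinkling argument of `upsetExchange_any` (weights `(1−ε)w + ε` inside
`S`, KN Lemma 3(i) `knLemma3i` for the event `E ∩ {D open}`, conditioning on `{D open}` = gluing
(`gluingLemma5_real_inter_allOpen`), continuity in the weights, `ε → 0`).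
-/

namespace Summit.CriticalPhenomena.PercolationContinuityZ3.Theorems

open MeasureTheory Set ProbabilityTheory Filter Topology
open Literature.Probability.LatticeModels
open Literature.Probability.Percolation

noncomputable section
open Classical

namespace UpsetExchange

variable {n : ℕ}

/-- **Up-set exchange for a general event.**  `S` a block, `v` the anchor, `E` any event such that
`E ∩ {every non-loop pair inside S open}` is increasing in the open edge cluster of `v`; if `μ_w(a ↔ b) ≤ μ_w(v ↔ b)`
then `μ_{glue_S w}(a ↔ b, E) ≤ μ_{glue_S w}(v ↔ b, E)`.
[cite: KozmaNitzan2024, Lemma 5 and Lemma 3(i) (pp. 6, 13); VandenbergHaggstromKahn2005, Thm. 1.2] -/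
theorem upsetExchange_event (w : Sym2 (Fin n) → unitInterval) (S : Finset (Fin n)) (a b v : Fin n)
    (E : Set (BondConfig (Fin n)))
    (hE : ∀ ω ω' : BondConfig (Fin n), ω ∈ E →
      (∀ e : Sym2 (Fin n), (∀ x ∈ e, x ∈ S) → ¬ e.IsDiag → e ∈ ω) →
      openEdgeCluster ω v ⊆ openEdgeCluster ω' v →
      ω' ∈ E ∧ ∀ e : Sym2 (Fin n), (∀ x ∈ e, x ∈ S) → ¬ e.IsDiag → e ∈ ω')
    (hyp : (prodBernoulli w).real (openConn a b) ≤ (prodBernoulli w).real (openConn v b)) :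
    (prodBernoulli (fun e : Sym2 (Fin n) => if (∀ x ∈ e, x ∈ S) ∧ ¬ e.IsDiag then 1 else w e)).real
        (openConn a b ∩ E) ≤
      (prodBernoulli (fun e : Sym2 (Fin n) => if (∀ x ∈ e, x ∈ S) ∧ ¬ e.IsDiag then 1 else w e)).real
        (openConn v b ∩ E) := by
  classical
  set g : Sym2 (Fin n) → unitInterval := fun e => if (∀ x ∈ e, x ∈ S) ∧ ¬ e.IsDiag then 1 else w e with hg
  set D : Finset (Sym2 (Fin n)) := Finset.univ.filter (fun e => (∀ x ∈ e, x ∈ S) ∧ ¬ e.IsDiag) with hDdef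
  have hD : ∀ e, e ∈ D ↔ (∀ x ∈ e, x ∈ S) ∧ ¬ e.IsDiag := fun e => by simp [hDdef]
  set ED : Set (BondConfig (Fin n)) := {ω | (↑D : Set (Sym2 (Fin n))) ⊆ ω} with hEDdef
  set Q : Set (BondConfig (Fin n)) := E ∩ ED with hQdef
  -- `Q = E ∩ {D open}` is increasing in the open edge cluster of `v`
  have hQmono : ∀ ω ω', ω ∈ Q → openEdgeCluster ω v ⊆ openEdgeCluster ω' v → ω' ∈ Q := by
    intro ω ω' hω hsub
    have hF : ∀ e : Sym2 (Fin n), (∀ x ∈ e, x ∈ S) → ¬ e.IsDiag → e ∈ ω :=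
      fun e heS hed => hω.2 (Finset.mem_coe.2 ((hD e).2 ⟨heS, hed⟩))
    obtain ⟨hE', hF'⟩ := hE ω ω' hω.1 hF hsub
    refine ⟨hE', fun e he => ?_⟩
    have he' := (hD e).1 (Finset.mem_coe.1 he)
    exact hF' e he'.1 he'.2
  -- the sprinkled weights
  set u : unitInterval → Sym2 (Fin n) → unitInterval :=
    fun ε e => if e ∈ D then Set.Icc.convexComb (w e) 1 ε else w e with hu
  have hwu : ∀ ε, w ≤ u ε := by
    intro ε e
    by_cases he : e ∈ D
    · simp only [hu, he, if_true]
      exact Set.Icc.le_convexComb unitInterval.le_one' ε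
    · simp only [hu, he, if_false]
      exact le_rfl
  have hu0 : u 0 = w := by
    funext e
    by_cases he : e ∈ D
    · simp only [hu, he, if_true, Set.Icc.convexComb_zero]
    · simp only [hu, he, if_false]
  have hucont : Continuous u := by
    refine continuous_pi fun e => ?_
    by_cases he : e ∈ D
    · simp only [hu, he, if_true]
      exact Set.Icc.continuous_convexComb (w e) 1
    · simp only [hu, he, if_false]
      exact continuous_const
  have hpin : ∀ ε, (fun e => if e ∈ D then (1 : unitInterval) else u ε e) = g := by
    intro ε
    funext e
    by_cases he : e ∈ D
    · simp only [hg, he, if_true, if_pos ((hD e).1 he)]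
    · have he' : ¬ ((∀ x ∈ e, x ∈ S) ∧ ¬ e.IsDiag) := fun h => he ((hD e).2 h)
      simp only [hg, hu, he, if_false, if_neg he']
  -- conditioning on `ED` is gluing (for any event, in particular `X ∩ E`)
  have hcond : ∀ ε (X : Set (BondConfig (Fin n))),
      (prodBernoulli (u ε)).real (X ∩ Q) = (prodBernoulli (u ε)).real ED * (prodBernoulli g).real (X ∩ E) := by
    intro ε X
    rw [hQdef, ← inter_assoc, hEDdef, gluingLemma5_real_inter_allOpen (u ε) D MeasurableSet.of_discrete, hpin ε]
  have hcondQ : ∀ ε, (prodBernoulli (u ε)).real Q = (prodBernoulli (u ε)).real ED * (prodBernoulli g).real E := by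
    intro ε
    have := hcond ε univ
    rwa [univ_inter, univ_inter] at this
  have hpos : ∀ ε : unitInterval, 0 < (ε : ℝ) → 0 < (prodBernoulli (u ε)).real ED := by
    intro ε hε
    rw [hEDdef, prodBernoulli_real_subset (u ε) D]
    refine Finset.prod_pos fun e he => ?_
    simp only [hu, he, if_true, Set.Icc.coe_convexComb, Set.Icc.coe_one, mul_one]
    exact add_pos_of_nonneg_of_pos
      (mul_nonneg (unitInterval.one_minus_nonneg ε) (unitInterval.nonneg (w e))) hε
  -- the step at fixed `ε > 0`
  have hstep : ∀ ε : unitInterval, 0 < (ε : ℝ) →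
      (prodBernoulli g).real (openConn a b ∩ E) ≤ (prodBernoulli g).real (openConn v b ∩ E) +
        ((prodBernoulli (u ε)).real (openConn a b) - (prodBernoulli w).real (openConn a b)) := by
    intro ε hε
    have hma : (prodBernoulli w).real (openConn a b) ≤ (prodBernoulli (u ε)).real (openConn a b) :=
      prodBernoulli_real_mono_of_isUpperSet (hwu ε) (isUpperSet_openConn a b) MeasurableSet.of_discrete
    have hmv : (prodBernoulli w).real (openConn v b) ≤ (prodBernoulli (u ε)).real (openConn v b) :=
      prodBernoulli_real_mono_of_isUpperSet (hwu ε) (isUpperSet_openConn v b) MeasurableSet.of_discrete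
    have h3 := knLemma3i n (u ε) a v b Q
      ((prodBernoulli (u ε)).real (openConn a b) - (prodBernoulli w).real (openConn a b))
      hQmono (sub_nonneg.2 hma) (by linarith)
    rw [hcond ε (openConn a b), hcond ε (openConn v b), hcondQ ε] at h3
    have hEC1 : (prodBernoulli g).real E ≤ 1 := measureReal_le_one
    have hd0 : 0 ≤ (prodBernoulli (u ε)).real (openConn a b) - (prodBernoulli w).real (openConn a b) :=
      sub_nonneg.2 hma
    have h4 : (prodBernoulli (u ε)).real ED * (prodBernoulli g).real (openConn a b ∩ E) ≤
        (prodBernoulli (u ε)).real ED * ((prodBernoulli g).real (openConn v b ∩ E) +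
          ((prodBernoulli (u ε)).real (openConn a b) - (prodBernoulli w).real (openConn a b))) := by
      have hED0 : 0 ≤ (prodBernoulli (u ε)).real ED := measureReal_nonneg
      nlinarith [h3, mul_le_mul_of_nonneg_left hEC1 (mul_nonneg hd0 hED0)]
    exact le_of_mul_le_mul_left h4 (hpos ε hε)
  -- `ε → 0`
  obtain ⟨ε, hεpos, hεlim⟩ := gluingLemma5_exists_seq_tendsto_zero
  have hF : Continuous fun t : unitInterval => (prodBernoulli (u t)).real (openConn a b) :=
    (stub_weightContinuity n (openConn a b)).comp hucont
  have hlim : Tendsto (fun k => (prodBernoulli g).real (openConn v b ∩ E) +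
      ((prodBernoulli (u (ε k))).real (openConn a b) - (prodBernoulli w).real (openConn a b)))
      atTop (𝓝 ((prodBernoulli g).real (openConn v b ∩ E) +
        ((prodBernoulli (u 0)).real (openConn a b) - (prodBernoulli w).real (openConn a b)))) :=
    tendsto_const_nhds.add (((hF.tendsto 0).comp hεlim).sub tendsto_const_nhds)
  rw [hu0, sub_self, add_zero] at hlim
  exact ge_of_tendsto' hlim fun k => hstep (ε k) (hεpos k)

/-- **Up-set exchange for a UNION of up-set pieces** (anchor outside the block).  `v ∉ S`; `𝒞` a finite family of
finite sets of non-loop pairs meeting `S`, each `C ∈ 𝒞` containing a pair `s(s_C, v)` with `s_C ∈ S`;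
`E = {ω | ∃ C ∈ 𝒞, C ⊆ ω}`.  If `μ_w(a ↔ b) ≤ μ_w(v ↔ b)` then `μ_{glue_S w}(a ↔ b, E) ≤ μ_{glue_S w}(v ↔ b, E)`.
With `𝒞 = {{e} : e a pair between S and v}` this is the relay-level exchange "some pair to `v` is open".
[cite: KozmaNitzan2024, Lemma 5 and Lemma 3(i) (pp. 6, 13); VandenbergHaggstromKahn2005, Thm. 1.2] -/
theorem upsetExchange_union (w : Sym2 (Fin n) → unitInterval) (S : Finset (Fin n)) (a b v : Fin n)
    (hvS : v ∉ S) (𝒞 : Finset (Finset (Sym2 (Fin n))))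
    (h𝒞 : ∀ C ∈ 𝒞, (∀ e ∈ C, ¬ e.IsDiag ∧ ∃ x ∈ e, x ∈ S) ∧ ∃ s₀ ∈ S, s(s₀, v) ∈ C)
    (hyp : (prodBernoulli w).real (openConn a b) ≤ (prodBernoulli w).real (openConn v b)) :
    (prodBernoulli (fun e : Sym2 (Fin n) => if (∀ x ∈ e, x ∈ S) ∧ ¬ e.IsDiag then 1 else w e)).real
        (openConn a b ∩ {ω | ∃ C ∈ 𝒞, (↑C : Set (Sym2 (Fin n))) ⊆ ω}) ≤
      (prodBernoulli (fun e : Sym2 (Fin n) => if (∀ x ∈ e, x ∈ S) ∧ ¬ e.IsDiag then 1 else w e)).real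
        (openConn v b ∩ {ω | ∃ C ∈ 𝒞, (↑C : Set (Sym2 (Fin n))) ⊆ ω}) := by
  refine upsetExchange_event w S a b v _ ?_ hyp
  intro ω ω' hω hF hsub
  obtain ⟨C, hC𝒞, hCω⟩ := hω
  obtain ⟨hC, s₀, hs₀, hsv⟩ := h𝒞 C hC𝒞
  have hvs₀ : v ≠ s₀ := fun h => hvS (h ▸ hs₀)
  have key := subset_openEdgeCluster_of_open S C v s₀ hs₀ hsv hvs₀ hC ω hF hCω
  refine ⟨⟨C, hC𝒞, fun e he => openEdgeCluster_subset ω' v (hsub (key.2 he))⟩, fun e heS hed => ?_⟩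
  exact openEdgeCluster_subset ω' v (hsub (key.1 e heS hed))

/-- **Block form** of `upsetExchange_union`: on `E` the anchor `v` is joined to the block by an open pair, so the
bound is by `μ_{glue_S w}(S ↔ b, E)` with `{S ↔ b} = ⋃_{s ∈ S} {s ↔ b}`. [cite: KozmaNitzan2024, Lemma 5 (p. 13)] -/
theorem upsetExchange_union_block (w : Sym2 (Fin n) → unitInterval) (S : Finset (Fin n)) (a b v : Fin n)
    (hvS : v ∉ S) (𝒞 : Finset (Finset (Sym2 (Fin n))))
    (h𝒞 : ∀ C ∈ 𝒞, (∀ e ∈ C, ¬ e.IsDiag ∧ ∃ x ∈ e, x ∈ S) ∧ ∃ s₀ ∈ S, s(s₀, v) ∈ C)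
    (hyp : (prodBernoulli w).real (openConn a b) ≤ (prodBernoulli w).real (openConn v b)) :
    (prodBernoulli (fun e : Sym2 (Fin n) => if (∀ x ∈ e, x ∈ S) ∧ ¬ e.IsDiag then 1 else w e)).real
        (openConn a b ∩ {ω | ∃ C ∈ 𝒞, (↑C : Set (Sym2 (Fin n))) ⊆ ω}) ≤
      (prodBernoulli (fun e : Sym2 (Fin n) => if (∀ x ∈ e, x ∈ S) ∧ ¬ e.IsDiag then 1 else w e)).real
        ((⋃ s ∈ S, openConn s b) ∩ {ω | ∃ C ∈ 𝒞, (↑C : Set (Sym2 (Fin n))) ⊆ ω}) := by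
  refine (upsetExchange_union w S a b v hvS 𝒞 h𝒞 hyp).trans (measureReal_mono ?_ (measure_ne_top _ _))
  rintro ω ⟨hvb, C, hC𝒞, hCω⟩
  refine ⟨?_, C, hC𝒞, hCω⟩
  obtain ⟨-, s₀, hs₀, hsv⟩ := h𝒞 C hC𝒞
  have he : s(s₀, v) ∈ ω := hCω (Finset.mem_coe.2 hsv)
  have hadj : (openGraph ω).Adj s₀ v := (openGraph_adj ω s₀ v).2 ⟨he, fun h => hvS (h ▸ hs₀)⟩
  exact Set.mem_iUnion₂.2 ⟨s₀, hs₀, hadj.reachable.trans hvb⟩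

/-- If every non-loop pair inside `S` is open and `v ∈ S`, then every member of `S` is reachable from `v`, and every
open non-loop pair meeting `S` lies in the open edge cluster of `v`. [folklore] -/
theorem mem_openEdgeCluster_of_open_mem (S : Finset (Fin n)) (v : Fin n) (hvS : v ∈ S)
    (ω : BondConfig (Fin n))
    (hF : ∀ e : Sym2 (Fin n), (∀ x ∈ e, x ∈ S) → ¬ e.IsDiag → e ∈ ω) :
    (∀ s ∈ S, (openGraph ω).Reachable v s) ∧
      ∀ e : Sym2 (Fin n), e ∈ ω → ¬ e.IsDiag → (∃ x ∈ e, x ∈ S) → e ∈ openEdgeCluster ω v := by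
  have hvS' : ∀ s ∈ S, (openGraph ω).Reachable v s := by
    intro s hs
    by_cases hsv : s = v
    · rw [hsv]
    · have he : s(v, s) ∈ ω := hF _ (fun x hx => by
        rcases Sym2.mem_iff.1 hx with rfl | rfl <;> assumption) (by
        rw [Sym2.mk_isDiag_iff]; exact fun h => hsv h.symm)
      exact ((openGraph_adj ω v s).2 ⟨he, fun h => hsv h.symm⟩).reachable
  refine ⟨hvS', fun e heω hed hxS => ?_⟩
  obtain ⟨x, hx, hxS⟩ := hxS
  refine ⟨heω, hed, fun y hy => ?_⟩
  by_cases hyx : y = x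
  · rw [hyx]; exact hvS' x hxS
  · have hexy : e = s(x, y) := (Sym2.mem_and_mem_iff (Ne.symm hyx)).1 ⟨hx, hy⟩
    have hxy : s(x, y) ∈ ω := by rw [← hexy]; exact heω
    exact (hvS' x hxS).trans ((openGraph_adj ω x y).2 ⟨hxy, Ne.symm hyx⟩).reachable

/-- **Up-set exchange with the anchor INSIDE the block.**  `v ∈ S`; `𝒞` any finite family of finite sets of non-loop
pairs meeting `S`; `E = {ω | ∃ C ∈ 𝒞, C ⊆ ω}`.  If `μ_w(a ↔ b) ≤ μ_w(v ↔ b)` (comparison with ONE member of the block in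
the unglued ranking graph `w`) then `μ_{glue_S w}(a ↔ b, E) ≤ μ_{glue_S w}(v ↔ b, E)`.
[cite: KozmaNitzan2024, Lemma 3(i) (p. 6); VandenbergHaggstromKahn2005, Thm. 1.2] -/
theorem hubExchange_union (w : Sym2 (Fin n) → unitInterval) (S : Finset (Fin n)) (a b v : Fin n)
    (hvS : v ∈ S) (𝒞 : Finset (Finset (Sym2 (Fin n))))
    (h𝒞 : ∀ C ∈ 𝒞, ∀ e ∈ C, ¬ e.IsDiag ∧ ∃ x ∈ e, x ∈ S)
    (hyp : (prodBernoulli w).real (openConn a b) ≤ (prodBernoulli w).real (openConn v b)) :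
    (prodBernoulli (fun e : Sym2 (Fin n) => if (∀ x ∈ e, x ∈ S) ∧ ¬ e.IsDiag then 1 else w e)).real
        (openConn a b ∩ {ω | ∃ C ∈ 𝒞, (↑C : Set (Sym2 (Fin n))) ⊆ ω}) ≤
      (prodBernoulli (fun e : Sym2 (Fin n) => if (∀ x ∈ e, x ∈ S) ∧ ¬ e.IsDiag then 1 else w e)).real
        (openConn v b ∩ {ω | ∃ C ∈ 𝒞, (↑C : Set (Sym2 (Fin n))) ⊆ ω}) := by
  refine upsetExchange_event w S a b v _ ?_ hyp
  intro ω ω' hω hF hsub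
  obtain ⟨C, hC𝒞, hCω⟩ := hω
  have key := mem_openEdgeCluster_of_open_mem S v hvS ω hF
  refine ⟨⟨C, hC𝒞, fun e he => ?_⟩, fun e heS hed => ?_⟩
  · obtain ⟨hed, hxS⟩ := h𝒞 C hC𝒞 e (Finset.mem_coe.1 he)
    exact openEdgeCluster_subset ω' v (hsub (key.2 e (hCω he) hed hxS))
  · have heω : e ∈ ω := hF e heS hed
    have hSne : ∃ x ∈ e, x ∈ S := by
      induction e using Sym2.ind with
      | h x y => exact ⟨x, Sym2.mem_mk_left x y, heS x (Sym2.mem_mk_left x y)⟩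
    exact openEdgeCluster_subset ω' v (hsub (key.2 e heω hed hSne))

/-- **Hub-domination leaf for Question 9 on a glued block.**  `u ∈ S`, `A` any finite set of vertices; if the relay
`a` is at most as connected to `b` as the member `u` in the ranking graph `w` (`μ_w(a ↔ b) ≤ μ_w(u ↔ b)`), then
`μ_{glue_S w}(a ↔ b, S ↔ A) ≤ μ_{glue_S w}(S ↔ b)`, where `S ↔ A = ⋃_{s∈S} ⋃_{a'∈A} {s ↔ a'}` and
`S ↔ b = ⋃_{s∈S} {s ↔ b}`.  (Kozma–Nitzan's (41)/(2) for the block with anchor `a`, certified by one member.)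
[cite: KozmaNitzan2024, Lemma 3(i) (p. 6), Question 9 (p. 36); VandenbergHaggstromKahn2005, Thm. 1.2] -/
theorem blockQ9_of_hubDominated (w : Sym2 (Fin n) → unitInterval) (S A : Finset (Fin n)) (a b u : Fin n)
    (huS : u ∈ S)
    (hyp : (prodBernoulli w).real (openConn a b) ≤ (prodBernoulli w).real (openConn u b)) :
    (prodBernoulli (fun e : Sym2 (Fin n) => if (∀ x ∈ e, x ∈ S) ∧ ¬ e.IsDiag then 1 else w e)).real
        (openConn a b ∩ ⋃ s ∈ S, ⋃ a' ∈ A, openConn s a') ≤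
      (prodBernoulli (fun e : Sym2 (Fin n) => if (∀ x ∈ e, x ∈ S) ∧ ¬ e.IsDiag then 1 else w e)).real
        (⋃ s ∈ S, openConn s b) := by
  set E : Set (BondConfig (Fin n)) := ⋃ s ∈ S, ⋃ a' ∈ A, openConn s a' with hEdef
  have hE : ∀ ω ω' : BondConfig (Fin n), ω ∈ E →
      (∀ e : Sym2 (Fin n), (∀ x ∈ e, x ∈ S) → ¬ e.IsDiag → e ∈ ω) →
      openEdgeCluster ω u ⊆ openEdgeCluster ω' u →
      ω' ∈ E ∧ ∀ e : Sym2 (Fin n), (∀ x ∈ e, x ∈ S) → ¬ e.IsDiag → e ∈ ω' := by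
    intro ω ω' hω hF hsub
    have key := mem_openEdgeCluster_of_open_mem S u huS ω hF
    refine ⟨?_, fun e heS hed => ?_⟩
    · rw [hEdef] at hω ⊢
      obtain ⟨s, hs, a', ha', hsa'⟩ : ∃ s ∈ S, ∃ a' ∈ A, ω ∈ (openConn s a' : Set (BondConfig (Fin n))) := by
        simpa only [Set.mem_iUnion, exists_prop] using hω
      have hua' : (openGraph ω).Reachable u a' := (key.1 s hs).trans hsa'
      have hua'' : (openGraph ω').Reachable u a' := by
        rw [reachable_iff_exists_mem_openEdgeCluster] at hua' ⊢
        rcases hua' with h | ⟨e, he, hae⟩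
        · exact Or.inl h
        · exact Or.inr ⟨e, hsub he, hae⟩
      have : ω' ∈ (openConn u a' : Set (BondConfig (Fin n))) := hua''
      simpa only [Set.mem_iUnion, exists_prop] using ⟨u, huS, a', ha', this⟩
    · have heω : e ∈ ω := hF e heS hed
      have hSne : ∃ x ∈ e, x ∈ S := by
        induction e using Sym2.ind with
        | h x y => exact ⟨x, Sym2.mem_mk_left x y, heS x (Sym2.mem_mk_left x y)⟩
      exact openEdgeCluster_subset ω' u (hsub (key.2 e heω hed hSne))
  have h1 := upsetExchange_event w S a b u E hE hyp
  refine h1.trans (measureReal_mono ?_ (measure_ne_top _ _))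
  rintro ω ⟨hub, -⟩
  exact Set.mem_iUnion₂.2 ⟨u, huS, hub⟩

end UpsetExchange


end

end Summit.CriticalPhenomena.PercolationContinuityZ3.Theorems
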